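import Mathlib
import Summits.NavierStokesRegularity.NavierStokesRegularity.Theorems.TaoLadderRungTwoBreakBlowupRigidityOneEveryShellFires
import HarnessLib

/-!
# (S₁)-SURVIVAL OF THE RENORMALISED BLOW-UP ⟺ THE `(1+ε₀)^n`-WEIGHTED PEAK SHELL ENERGIES DO NOT TEND TO ZERO — the
  lateness clause is automatic — support for `stub_eternalFromBlowup` of K2(1) `TaoLadderRungTwoBreak.BlowupRigidityOne`
  (stmt-NavierStokesRegularity-20206)

MODEL lattice ODEs only (Tao 2016 §4 Lemma 4.1 (4.5), (4.12), §6.4); nothing here is a statement about the Navier–Stokes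
equations; NO item is closed (`--supports stmt-NavierStokesRegularity-20206`). General `m`; DEF-FREE.

The survival half of the extraction stub asks, for the renormalisation `W_n(σ) = Λ^n e^{-σ} x_n(T - e^{-σ})` of a flow on `[0,T)`
(or an ω-limit of it), `EternalSurvivingFwd 1 ε₀ W`: a level `c > 0` of `(1+ε₀)^n ‖x_n(t)‖²` reached at arbitrarily HIGH shells
at arbitrarily LATE log-times (`eternalSurvivingFwd_of_physicalSurvival`, p816109, asks for `t ≥ T - e^{-N}`). Here the lateness
is shown to be AUTOMATIC under the a-priori regularity (4.5) before `T`: on `[0,T']` shell `n` carries at most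
`M(T')²·m·(1+ε₀)^{-20n}`, so `(1+ε₀)^n ‖x_n(t)‖² < c` there for large `n` — any shell reaching the level `c` far out does so late.
* `weightedEnergy_small_early` — for `T' < T` and `c > 0` there is `K` with `(1+ε₀)^n ‖x_n(t)‖² < c` for all `n ≥ K`, `t ∈ [0,T']`;
* `eternalSurvivingFwd_one_of_peaks` — **if `limsup_n sup_{t<T} (1+ε₀)^n‖x_n(t)‖² > 0`** (some `c > 0` is reached on
  infinitely many shells, anywhere in `[0,T)`), then the renormalisation is forward (S₁)-surviving;
* `peaks_of_eternalSurvivingFwd_one` — conversely, forward (S₁)-survival of the renormalisation gives such peaks;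
* `eternalSurvivingFwd_one_iff_peaks` — the equivalence, for any flow that is (4.5)-regular before `T`.

READING for ⟨20206⟩. Unconditionally (`EveryShellFires`, `OrderedIgnition`): the `(1+ε₀)^{5n}`-weighted peaks are `≥ (C_A T⋆ Λ)⁻²`
on EVERY shell and diverge along all but a sparse set of shells; the stub's survival half is EXACTLY the statement that the
`(1+ε₀)^{n}`-weighted peaks stay bounded below along a subsequence — four powers of `1+ε₀` per shell lower, the NS dissipation
scaling. HONEST LABEL: a reformulation; the peak statement itself ((F2b)-type front survival) is open; no stub, crux or summit
is proved; rung 0.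
-/

noncomputable section

-- the summit and its single sub-problem share the name (CONVENTIONS §1)
set_option linter.dupNamespace false

open Set Filter Topology MeasureTheory

namespace Summit.NavierStokesRegularity.NavierStokesRegularity.Theorems

namespace BlowupRigidityOne

open Literature.Analysis.FluidPDE Literature.Analysis.FluidPDE.TaoCascade

variable {m : ℕ}

/-- **Early on, high shells are small at the `a = 1` weight.** Under (4.5)-regularity before `T`: for every `T' < T` and
`c > 0` there is `K` such that `(1+ε₀)^n ‖x_n(t)‖² < c` for all shells `n ≥ K` and all `t ∈ [0,T']`.
[cite: Tao2016AveragedNS, §4 Lemma 4.1 (4.5)] -/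
theorem weightedEnergy_small_early {ε₀ T : ℝ} (hε : 0 < ε₀) {X : Fin m → ℤ → ℝ → ℝ}
    (hreg : ∀ T' : ℝ, T' < T → ∃ M : ℝ, ∀ t ∈ Icc 0 T', ∀ (i : Fin m) (k : ℤ),
      (1 + (1 + ε₀) ^ ((10 : ℝ) * k)) * |X i k t| ≤ M)
    {T' c : ℝ} (hT' : T' < T) (hc : 0 < c) :
    ∃ K : ℕ, ∀ n : ℕ, K ≤ n → ∀ t ∈ Icc 0 T', (1 + ε₀) ^ n * ‖shellVec X (n : ℤ) t‖ ^ 2 < c := by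
  have hb : (0 : ℝ) < 1 + ε₀ := by linarith
  have hb1 : (1 : ℝ) < 1 + ε₀ := by linarith
  obtain ⟨M, hM⟩ := hreg T' hT'
  -- componentwise: `(1+ε₀)^{10n} |X_{i,n}(t)| ≤ M`, hence `‖x_n(t)‖ ≤ √m |M| (1+ε₀)^{-10n}`
  have hcomp : ∀ (n : ℕ), ∀ t ∈ Icc (0:ℝ) T', ∀ i : Fin m, |X i (n : ℤ) t| ≤ |M| * (((1 + ε₀) ^ 10) ^ n)⁻¹ := by
    intro n t ht i
    have h := hM t ht i (n : ℤ)
    have h10 : (1 + ε₀) ^ ((10 : ℝ) * ((n : ℤ) : ℝ)) = ((1 + ε₀) ^ 10) ^ n := by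
      rw [show (10 : ℝ) * ((n : ℤ) : ℝ) = ((10 * n : ℕ) : ℝ) by push_cast; ring, Real.rpow_natCast, pow_mul]
    rw [h10] at h
    have hpos : 0 < ((1 + ε₀) ^ 10) ^ n := by positivity
    rw [← div_eq_mul_inv, le_div_iff₀ hpos]
    calc |X i (n : ℤ) t| * ((1 + ε₀) ^ 10) ^ n ≤ (1 + ((1 + ε₀) ^ 10) ^ n) * |X i (n : ℤ) t| := by
          nlinarith [abs_nonneg (X i (n : ℤ) t)]
      _ ≤ M := h
      _ ≤ |M| := le_abs_self M
  -- choose `K` with `m |M|² (1+ε₀)^{-19 K} < c`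
  have hy1 : (((1 + ε₀) ^ 19)⁻¹ : ℝ) < 1 := inv_lt_one_of_one_lt₀ (one_lt_pow₀ hb1 (by norm_num))
  have hy0 : (0 : ℝ) ≤ ((1 + ε₀) ^ 19)⁻¹ := by positivity
  set A : ℝ := (m : ℝ) * |M| ^ 2 + 1 with hA
  have hA0 : 0 < A := by positivity
  obtain ⟨K, hK⟩ := exists_pow_lt_of_lt_one (div_pos hc hA0) hy1
  refine ⟨K, fun n hn t ht => ?_⟩
  have hnorm := norm_shellVec_le_sqrt_mul (by positivity) (hcomp n t ht)
  have hyn : (((1 + ε₀) ^ 19)⁻¹) ^ n ≤ (((1 + ε₀) ^ 19)⁻¹) ^ K := pow_le_pow_of_le_one hy0 hy1.le hn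
  -- `(1+ε₀)^n ‖x_n‖² ≤ (1+ε₀)^n · m |M|² (1+ε₀)^{-20n} = m|M|² ((1+ε₀)^{19})⁻¹^n`
  have hq : (1 + ε₀) ^ n * (Real.sqrt m * (|M| * (((1 + ε₀) ^ 10) ^ n)⁻¹)) ^ 2 =
      (m : ℝ) * |M| ^ 2 * (((1 + ε₀) ^ 19)⁻¹) ^ n := by
    rw [mul_pow, Real.sq_sqrt (Nat.cast_nonneg m), mul_pow, inv_pow, inv_pow, ← pow_mul, ← pow_mul, ← pow_mul]
    have hne : (1 + ε₀) ^ (10 * n * 2) ≠ 0 := pow_ne_zero _ hb.ne'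
    have hne' : (1 + ε₀) ^ (19 * n) ≠ 0 := pow_ne_zero _ hb.ne'
    field_simp
    ring
  calc (1 + ε₀) ^ n * ‖shellVec X (n : ℤ) t‖ ^ 2
      ≤ (1 + ε₀) ^ n * (Real.sqrt m * (|M| * (((1 + ε₀) ^ 10) ^ n)⁻¹)) ^ 2 :=
        mul_le_mul_of_nonneg_left (pow_le_pow_left₀ (norm_nonneg _) hnorm 2) (pow_nonneg hb.le n)
    _ = (m : ℝ) * |M| ^ 2 * (((1 + ε₀) ^ 19)⁻¹) ^ n := hq
    _ ≤ A * (((1 + ε₀) ^ 19)⁻¹) ^ K := by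
        refine mul_le_mul (by rw [hA]; linarith) hyn (pow_nonneg hy0 n) hA0.le
    _ < A * (c / A) := mul_lt_mul_of_pos_left hK hA0
    _ = c := mul_div_cancel₀ c hA0.ne'

/-- **PEAKS ⇒ (S₁)-SURVIVAL.** If a flow on `[0,T)` ((4.5)-regular before `T`) reaches a fixed level `c > 0` of
`(1+ε₀)^n ‖x_n(t)‖²` on infinitely many shells (anywhere in `[0,T)`), its renormalisation around `T` is forward (S₁)-surviving.
[cite: Tao2016AveragedNS, §4 Lemma 4.1 (4.5), §6.4; cell vocabulary (`EternalSurvivingFwd`)] -/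
theorem eternalSurvivingFwd_one_of_peaks {ε₀ T : ℝ} (hε : 0 < ε₀) {X : Fin m → ℤ → ℝ → ℝ}
    (hreg : ∀ T' : ℝ, T' < T → ∃ M : ℝ, ∀ t ∈ Icc 0 T', ∀ (i : Fin m) (k : ℤ),
      (1 + (1 + ε₀) ^ ((10 : ℝ) * k)) * |X i k t| ≤ M)
    {W : ℤ → ℝ → Em m}
    (hW : ∀ n σ, W n σ = (bigLam ε₀ ^ n * Real.exp (-σ)) • shellVec X n (T - Real.exp (-σ)))
    {c : ℝ} (hc : 0 < c)
    (hpeaks : ∀ N : ℕ, ∃ n : ℕ, N ≤ n ∧ ∃ t : ℝ, 0 ≤ t ∧ t < T ∧ c ≤ (1 + ε₀) ^ n * ‖shellVec X n t‖ ^ 2) :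
    EternalSurvivingFwd 1 ε₀ W := by
  refine eternalSurvivingFwd_of_physicalSurvival hε hW hc fun N => ?_
  -- lateness is automatic: beyond `T' = T - e^{-N}` (if positive) high shells are small early
  set T' : ℝ := T - Real.exp (-(N : ℝ)) with hT'
  have hT'T : T' < T := by have := Real.exp_pos (-(N : ℝ)); linarith
  obtain ⟨K, hK⟩ := weightedEnergy_small_early hε hreg hT'T hc
  obtain ⟨n, hn, t, ht0, htT, hct⟩ := hpeaks (max N K)
  refine ⟨n, (le_max_left _ _).trans hn, t, ?_, htT, hct⟩
  by_contra hlt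
  push Not at hlt
  exact absurd hct (not_le.2 (hK n ((le_max_right _ _).trans hn) t ⟨ht0, hlt.le⟩))

/-- **(S₁)-SURVIVAL ⇒ PEAKS.** Conversely, forward (S₁)-survival of the renormalisation gives a level `c > 0` of
`(1+ε₀)^n ‖x_n(t)‖²` on infinitely many shells at times `t ∈ [T - 1, T)` (log-times `σ ≥ N ≥ 0`).
[cite: Tao2016AveragedNS, §6.4; cell vocabulary (`EternalSurvivingFwd`)] -/
theorem peaks_of_eternalSurvivingFwd_one {ε₀ T : ℝ} (hε : 0 < ε₀) {X : Fin m → ℤ → ℝ → ℝ}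
    {W : ℤ → ℝ → Em m}
    (hW : ∀ n σ, W n σ = (bigLam ε₀ ^ n * Real.exp (-σ)) • shellVec X n (T - Real.exp (-σ)))
    (hsurv : EternalSurvivingFwd 1 ε₀ W) :
    ∃ c : ℝ, 0 < c ∧ ∀ N : ℕ, ∃ n : ℕ, N ≤ n ∧ ∃ t : ℝ, T - 1 ≤ t ∧ t < T ∧
      c ≤ (1 + ε₀) ^ n * ‖shellVec X n t‖ ^ 2 := by
  obtain ⟨c, hc, h⟩ := hsurv
  refine ⟨c, hc, fun N => ?_⟩
  obtain ⟨n, hn, σ, hσ, hcσ⟩ := h N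
  refine ⟨n, hn, T - Real.exp (-σ), ?_, by linarith [Real.exp_pos (-σ)], ?_⟩
  · have h1 : Real.exp (-σ) ≤ 1 := by
      rw [Real.exp_le_one_iff]
      have : (0 : ℝ) ≤ N := Nat.cast_nonneg N
      linarith
    linarith
  · rwa [renormalisedFlow_weightedEnergy hε hW] at hcσ

/-- **(S₁)-SURVIVAL OF THE RENORMALISATION ⟺ NON-VANISHING `(1+ε₀)^n`-WEIGHTED PEAKS** (for flows (4.5)-regular before
`T > 0`). [cite: Tao2016AveragedNS, §4 Lemma 4.1 (4.5), §6.4; cell vocabulary (`EternalSurvivingFwd`)] -/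
theorem eternalSurvivingFwd_one_iff_peaks {ε₀ T : ℝ} (hε : 0 < ε₀) (hT : 0 < T) {X : Fin m → ℤ → ℝ → ℝ}
    (hreg : ∀ T' : ℝ, T' < T → ∃ M : ℝ, ∀ t ∈ Icc 0 T', ∀ (i : Fin m) (k : ℤ),
      (1 + (1 + ε₀) ^ ((10 : ℝ) * k)) * |X i k t| ≤ M)
    {W : ℤ → ℝ → Em m}
    (hW : ∀ n σ, W n σ = (bigLam ε₀ ^ n * Real.exp (-σ)) • shellVec X n (T - Real.exp (-σ))) :
    EternalSurvivingFwd 1 ε₀ W ↔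
      ∃ c : ℝ, 0 < c ∧ ∀ N : ℕ, ∃ n : ℕ, N ≤ n ∧ ∃ t : ℝ, 0 ≤ t ∧ t < T ∧
        c ≤ (1 + ε₀) ^ n * ‖shellVec X n t‖ ^ 2 := by
  constructor
  · intro h
    -- survival witnesses may sit at `t < 0` only if `T < 1`; extract with `σ ≥ N` large so that `t ≥ 0`
    obtain ⟨c', hc', h'⟩ := h
    refine ⟨c', hc', fun N => ?_⟩
    -- take `N' ≥ N` with `e^{-N'} ≤ T`, then `t = T - e^{-σ} ≥ 0` for `σ ≥ N'`
    obtain ⟨N₁, hN₁⟩ := exists_nat_gt (-Real.log T)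
    obtain ⟨n, hn, σ, hσ, hcσ⟩ := h' (max N N₁)
    refine ⟨n, (le_max_left _ _).trans hn, T - Real.exp (-σ), ?_, by linarith [Real.exp_pos (-σ)], ?_⟩
    · have hσ' : -Real.log T < σ := by
        have : (N₁ : ℝ) ≤ ((max N N₁ : ℕ) : ℝ) := by exact_mod_cast le_max_right N N₁
        linarith
      have : Real.exp (-σ) ≤ T := by
        rw [← Real.exp_log hT]
        exact Real.exp_le_exp.2 (by linarith)
      linarith
    · rwa [renormalisedFlow_weightedEnergy hε hW] at hcσ
  · rintro ⟨c, hc, hp⟩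
    exact eternalSurvivingFwd_one_of_peaks hε hreg hW hc hp

end BlowupRigidityOne

end Summit.NavierStokesRegularity.NavierStokesRegularity.Theorems

end
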